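import Literature.AlgebraicGeometry.ShimuraVarieties.FramedConeChart
import Literature.NumberTheory.Automorphic.UnitaryGroupCongruenceCocompact
import HarnessLib

/-!
# The arithmetic lattice `T⁻¹ Γ^{τ₁} T ≤ U(2,1)` on the framed cone chart: the projection `negCone → Δ\𝔹²`

Namespace `Literature.AlgebraicGeometry.ShimuraVarieties.FramedCone` (sequel of `FramedConeChart.lean`).  Definitions with bodies and theorems only; no named fact, no `sorry`.

For a CM field `E ⊂ ℂ`, `H ∈ M₃(E)`, a congruence subgroup `Γ` of `U(H)(E⁺)` (`IsCongruenceSubgroup (conjRingHom E) H Γ`)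
and a frame `T` (`Tᴴ H^{τ₁} T = diag(1,1,-1)`) — the binders of `PicardCM.BallQuotientUniformised` — DATUM-FREE
(assembly `ShimuraVarieties/BallQuotientUniformisedOf.lean`):

* § 3: isometries of `(E³, H)` preserve the negative cone of `H^{τ₁}` (`map_mulVec_mem_negCone`); the lattice
  `Δ = {T⁻¹ γ^{τ₁} T | γ ∈ Γ} ≤ U(2,1)` IS the tree's `UnitaryGroup.archImageU21 (↥E) H E.subtype T _ Γ` (`lattice`, an
  `abbrev`); the element `latticeElt hγ` attached to `γ ∈ Γ` has matrix `T⁻¹ γ^{τ₁} T` (`mat_latticeElt`, from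
  `UnitaryGroup.coe_archProjU21EmbCM_rationalToArch`), every lattice element is of this form (`exists_eq_latticeElt`),
  and `latticeElt hγ • coneChart v = coneChart (γ^{τ₁} v)` (`latticeElt_smul_coneChart`);
* § 4 (for `Δ` acting properly discontinuously and freely, so that `Δ\𝔹²` is the complex manifold
  `MulAction.orbitRel.Quotient Δ Ball` of `BallModel.instIsManifoldQuotient`): the projection
  `coneProj : negCone H^{τ₁} → Δ\𝔹²`, `v ↦ Δ · proj (T⁻¹ v)` — continuous, OPEN, onto, with fibres exactly the
  `Γ·ℂˣ`-orbits (`coneProj_eq_iff`: `coneProj v = coneProj w ↔ ∃ γ ∈ Γ, ∃ c ≠ 0, γ^{τ₁} v = c • w`, the fibre clause of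
  `PicardCM.IsBallUniformisation`); the total extension `coneExtend` of a function on the cone to `ℂ³`; and the
  HOLOMORPHY GLUE `differentiableAt_coneExtend_comp_coneProj`: `k ∘ coneProj`, extended to `ℂ³`, is complex
  differentiable at every cone vector above which `k` is manifold-differentiable on `Δ\𝔹²`.

References: N. Bergeron, J. Millson, C. Moeglin, Acta Math. 216 (2016), Introduction §1.1, Part 2 §§1.2–1.3;
A. Borel, H. Jacquet, Proc. Symp. Pure Math. 33.1 (1979) §4.1.  Everything below is PROVED.

Provenance: Literature home (namespace `Literature.AlgebraicGeometry.ShimuraVarieties.FramedCone`) of the Summits-side `HodgeConjecture/CorCM/Geometry/FramedConeLattice` (imports `Literature/` and Mathlib only), re-homed so that the Literature named facts it proves are discharged Literature-side under their exact names. Lane `lit-hodgefound`, seat p20.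
-/

set_option autoImplicit false

noncomputable section

open scoped Manifold ContDiff Matrix _root_.Topology ComplexOrder
open Set Function MulAction Matrix NumberField
open Literature.Geometry.ComplexHyperbolic
open Literature.Geometry.ComplexHyperbolic.BallModel (U21 Ball Q proj lift mat x₀ nsq)
open Literature.NumberTheory.Automorphic
open Literature.NumberTheory.Automorphic.UnitaryGroup
open Literature.AlgebraicGeometry.ShimuraVarieties (hermForm negCone mem_negCone_iff isOpen_negCone
  smul_mem_negCone signatureMatrix conjRingHom unitaryGroup mem_unitaryGroup_iff IsCongruenceSubgroup
  embedding_conjRingHom)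

namespace Literature.AlgebraicGeometry.ShimuraVarieties.FramedCone

/-! ## 3. The arithmetic lattice `Δ = T⁻¹ Γ^{τ₁} T ≤ U(2,1)` acting on the cone chart -/

section Lattice

variable (E : Subfield ℂ) [NumberField E] [IsCMField E] (H : Matrix (Fin 3) (Fin 3) E)

/-- Isometries of `(E³, H)` act on `ℂ³ = E³ ⊗_{E,τ₁} ℂ` preserving the complex form:
`(γ^{τ₁})ᴴ H^{τ₁} γ^{τ₁} = H^{τ₁}`. [cite: BergeronMillsonMoeglin2016Balls, Part 2 §1.2] -/
theorem conjTranspose_map_mul {γ : GL (Fin 3) E} (hγ : γ ∈ unitaryGroup (conjRingHom E) H) :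
    ((γ : Matrix (Fin 3) (Fin 3) E).map E.subtype)ᴴ * H.map E.subtype *
      (γ : Matrix (Fin 3) (Fin 3) E).map E.subtype = H.map E.subtype := by
  have h := congrArg (fun M : Matrix (Fin 3) (Fin 3) E ↦ M.map E.subtype) (mem_unitaryGroup_iff.1 hγ)
  simp only [Matrix.map_mul] at h
  have ht : (((γ : Matrix (Fin 3) (Fin 3) E).map (conjRingHom E))ᵀ).map E.subtype =
      ((γ : Matrix (Fin 3) (Fin 3) E).map E.subtype)ᴴ := by
    ext i j
    simp only [Matrix.map_apply, transpose_apply, conjTranspose_apply, Complex.star_def, embedding_conjRingHom]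
  rwa [ht] at h

/-- Isometries preserve the negative cone. [cite: BergeronMillsonMoeglin2016Balls, Part 2 §1.3] -/
theorem map_mulVec_mem_negCone {γ : GL (Fin 3) E} (hγ : γ ∈ unitaryGroup (conjRingHom E) H)
    {v : Fin 3 → ℂ} (hv : v ∈ negCone (H.map E.subtype)) :
    (γ : Matrix (Fin 3) (Fin 3) E).map E.subtype *ᵥ v ∈ negCone (H.map E.subtype) := by
  rw [mem_negCone_iff, Literature.AlgebraicGeometry.ShimuraVarieties.ConeChart.star_mulVec_dotProduct,
    conjTranspose_map_mul E H hγ]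
  exact hv

variable {E H}
variable {Γ : Subgroup (GL (Fin 3) E)} (hΓ : IsCongruenceSubgroup (conjRingHom E) H Γ)
  (T : GL (Fin 3) ℂ)
  (hT : (T : Matrix (Fin 3) (Fin 3) ℂ)ᴴ * H.map E.subtype * (T : Matrix (Fin 3) (Fin 3) ℂ) = signatureMatrix 2)

omit [NumberField E] [IsCMField E] in
include hT in
/-- The frame hypothesis in the tree's `J`-currency. [cite: Shafarevich1994, Book 3 Ch. IX §3.2, auxiliary step] -/
theorem frame_J : (T : Matrix (Fin 3) (Fin 3) ℂ)ᴴ * H.map E.subtype * (T : Matrix (Fin 3) (Fin 3) ℂ) = BallModel.J := by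
  rw [← Literature.AlgebraicGeometry.ShimuraVarieties.UnitaryBallUniformisationDatum.signatureMatrix_two]
  exact hT

/-- The lattice `Δ = {T⁻¹ γ^{τ₁} T | γ ∈ Γ} ≤ U(2,1)` of the record's data (the tree's `archImageU21`).
[cite: BorelJacquet1979, §4.1] -/
abbrev lattice (Γ : Subgroup (GL (Fin 3) E)) (T : GL (Fin 3) ℂ)
    (hT : (T : Matrix (Fin 3) (Fin 3) ℂ)ᴴ * H.map E.subtype * (T : Matrix (Fin 3) (Fin 3) ℂ) = signatureMatrix 2) :
    Subgroup U21 :=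
  archImageU21 (↥E) H E.subtype T (formCongr_eq_J_of_conjTranspose_mul_mul H E.subtype hT) Γ

/-- An element of a congruence subgroup as a rational point of `U(H)`. [cite: BergeronMillsonMoeglin2016Balls, Part 2 §1.3, auxiliary construction] -/
def toRational {γ : GL (Fin 3) E} (hγ : γ ∈ Γ) :
    rational (↥(maximalRealSubfield E)) E (IsCMField.complexConj E) 3 H :=
  ⟨γ, by rw [← unitaryGroup_conjRingHom_eq_rational]; exact hΓ.1 hγ⟩

/-- **The lattice element `T⁻¹ γ^{τ₁} T` attached to `γ ∈ Γ`.** [cite: BorelJacquet1979, §4.1] -/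
def latticeElt {γ : GL (Fin 3) E} (hγ : γ ∈ Γ) : lattice Γ T hT :=
  ⟨archProjU21EmbCM (↥E) H E.subtype T (formCongr_eq_J_of_conjTranspose_mul_mul H E.subtype hT)
      (rationalToArch (↥(maximalRealSubfield E)) E (IsCMField.complexConj E) 3 H (toRational hΓ hγ)),
    (mem_archImageU21_iff _ _ _ _ _ _ _).2 ⟨toRational hΓ hγ, hγ, rfl⟩⟩

/-- Its matrix is `T⁻¹ γ^{τ₁} T`. [cite: Shafarevich1994, Book 3 Ch. IX §3.2, auxiliary step] -/
theorem mat_latticeElt {γ : GL (Fin 3) E} (hγ : γ ∈ Γ) :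
    mat ((latticeElt hΓ T hT hγ : lattice Γ T hT) : U21) =
      ti T * (γ : Matrix (Fin 3) (Fin 3) E).map E.subtype * (T : Matrix (Fin 3) (Fin 3) ℂ) := by
  have h := coe_archProjU21EmbCM_rationalToArch (↥E) H E.subtype T
      (formCongr_eq_J_of_conjTranspose_mul_mul H E.subtype hT) (toRational hΓ hγ)
  exact congrArg Units.val h

/-- **Every lattice element comes from some `γ ∈ Γ`.** [cite: Shafarevich1994, Book 3 Ch. IX §3.2, auxiliary step] -/
theorem exists_eq_latticeElt (δ : lattice Γ T hT) : ∃ (γ : GL (Fin 3) E) (hγ : γ ∈ Γ),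
    latticeElt hΓ T hT hγ = δ := by
  obtain ⟨γ, hγ, hγδ⟩ := (mem_archImageU21_iff _ _ _ _ _ _ _).1 δ.2
  refine ⟨γ, hγ, Subtype.ext ?_⟩
  rw [← hγδ]
  rfl

/-- **The lattice acts on the cone chart through `Γ`**: `(T⁻¹ γ^{τ₁} T) • coneChart v = coneChart (γ^{τ₁} v)`.
[cite: BergeronMillsonMoeglin2016Balls, Part 2 §1.3] -/
theorem latticeElt_smul_coneChart {γ : GL (Fin 3) E} (hγ : γ ∈ Γ) (v : negCone (H.map E.subtype)) :
    (latticeElt hΓ T hT hγ : lattice Γ T hT) • coneChart T (frame_J T hT) v =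
      coneChart T (frame_J T hT) ⟨(γ : Matrix (Fin 3) (Fin 3) E).map E.subtype *ᵥ (v : Fin 3 → ℂ),
        map_mulVec_mem_negCone E H (hΓ.1 hγ) v.2⟩ := by
  rw [Subgroup.smul_def]
  exact smul_coneChart T (frame_J T hT) _ (mat_latticeElt hΓ T hT hγ) v _

end Lattice

/-! ## 4. The projection `cone → Δ\𝔹²` and its total extension to `ℂ³` -/

section Projection

variable {E : Subfield ℂ} [NumberField E] [IsCMField E] {H : Matrix (Fin 3) (Fin 3) E}
  {Γ : Subgroup (GL (Fin 3) E)} (hΓ : IsCongruenceSubgroup (conjRingHom E) H Γ)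
  (T : GL (Fin 3) ℂ)
  (hT : (T : Matrix (Fin 3) (Fin 3) ℂ)ᴴ * H.map E.subtype * (T : Matrix (Fin 3) (Fin 3) ℂ) = signatureMatrix 2)
  [ProperlyDiscontinuousSMul (lattice Γ T hT) Ball] [IsCancelSMul (lattice Γ T hT) Ball]

/-- The projection of the negative cone onto the quotient surface `Δ\𝔹²`: `v ↦ Δ · proj (T⁻¹ v)`.
[cite: BergeronMillsonMoeglin2016Balls, Introduction §1.1] -/
def coneProj (v : negCone (H.map E.subtype)) : orbitRel.Quotient (lattice Γ T hT) Ball :=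
  Literature.Geometry.Manifold.QuotientManifold.mk (G := lattice Γ T hT) (coneChart T (frame_J T hT) v)

omit [ProperlyDiscontinuousSMul (lattice Γ T hT) Ball] [IsCancelSMul (lattice Γ T hT) Ball] in
/-- The projection is continuous. [cite: Shafarevich1994, Book 3 Ch. IX §3.2, auxiliary step] -/
theorem continuous_coneProj : Continuous (coneProj T hT (Γ := Γ)) :=
  continuous_quotient_mk'.comp (continuous_coneChart T (frame_J T hT))

/-- The projection is an open map. [cite: Shafarevich1994, Book 3 Ch. IX §3.2, auxiliary step] -/
theorem isOpenMap_coneProj : IsOpenMap (coneProj T hT (Γ := Γ)) :=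
  (Literature.Geometry.Manifold.QuotientManifold.isLocalHomeomorph_mk (G := lattice Γ T hT)
      (M := Ball)).isOpenMap.comp (isOpenMap_coneChart T (frame_J T hT))

omit [ProperlyDiscontinuousSMul (lattice Γ T hT) Ball] [IsCancelSMul (lattice Γ T hT) Ball] in
/-- The projection is onto. [cite: Shafarevich1994, Book 3 Ch. IX §3.2, auxiliary step] -/
theorem coneProj_surjective : Surjective (coneProj T hT (Γ := Γ)) := by
  intro q
  obtain ⟨z, rfl⟩ := Quotient.exists_rep q
  obtain ⟨v, rfl⟩ := coneChart_surjective T (frame_J T hT) z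
  exact ⟨v, rfl⟩

include hΓ in
/-- **Fibres of the projection are the `Γ·ℂˣ`-orbits**: `coneProj v = coneProj w` iff `γ^{τ₁} v = c • w` for
some `γ ∈ Γ` and `c ≠ 0`. [cite: BergeronMillsonMoeglin2016Balls, Introduction §1.1] -/
theorem coneProj_eq_iff (v w : negCone (H.map E.subtype)) :
    coneProj T hT (Γ := Γ) v = coneProj T hT (Γ := Γ) w ↔
      ∃ γ ∈ Γ, ∃ c : ℂ, c ≠ 0 ∧
        ((γ : Matrix (Fin 3) (Fin 3) E).map E.subtype) *ᵥ (v : Fin 3 → ℂ) = c • (w : Fin 3 → ℂ) := by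
  rw [coneProj, coneProj, eq_comm, Literature.Geometry.Manifold.QuotientManifold.mk_eq_mk_iff]
  constructor
  · rintro ⟨δ, hδ⟩
    obtain ⟨γ, hγ, rfl⟩ := exists_eq_latticeElt hΓ T hT δ
    rw [latticeElt_smul_coneChart hΓ T hT hγ v, coneChart_eq_iff] at hδ
    obtain ⟨c, hc, hcw⟩ := hδ
    exact ⟨γ, hγ, c, hc, hcw⟩
  · rintro ⟨γ, hγ, c, hc, hcw⟩
    refine ⟨latticeElt hΓ T hT hγ, ?_⟩
    rw [latticeElt_smul_coneChart hΓ T hT hγ v, coneChart_eq_iff]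
    exact ⟨c, hc, hcw⟩

end Projection

section Extend

variable {E : Subfield ℂ} {H : Matrix (Fin 3) (Fin 3) E}

/-- Total extension to `ℂ³` of a function on the negative cone (junk value `y₀` off the cone; the record
`BallQuotientUniformised` asks for a map on all of `ℂ³`, meaningful on the cone only). [cite: BergeronMillsonMoeglin2016Balls, Part 2 §1.3, auxiliary construction] -/
def coneExtend {Y : Type*} (f : negCone (H.map E.subtype) → Y) (y₀ : Y) (v : Fin 3 → ℂ) : Y := by
  classical
  exact if hv : v ∈ negCone (H.map E.subtype) then f ⟨v, hv⟩ else y₀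

/-- On the cone the extension is the function. [cite: Shafarevich1994, Book 3 Ch. IX §3.2, auxiliary step] -/
theorem coneExtend_of_mem {Y : Type*} (f : negCone (H.map E.subtype) → Y) (y₀ : Y) {v : Fin 3 → ℂ}
    (hv : v ∈ negCone (H.map E.subtype)) : coneExtend f y₀ v = f ⟨v, hv⟩ := by
  classical
  exact dif_pos hv

/-- The restriction of the extension to the cone is the function. [cite: Shafarevich1994, Book 3 Ch. IX §3.2, auxiliary step] -/
theorem restrict_coneExtend {Y : Type*} (f : negCone (H.map E.subtype) → Y) (y₀ : Y) :
    (negCone (H.map E.subtype)).restrict (coneExtend f y₀) = f := by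
  funext v
  exact coneExtend_of_mem f y₀ v.2

end Extend

section ProjectionHolomorphy

variable {E : Subfield ℂ} [NumberField E] [IsCMField E] {H : Matrix (Fin 3) (Fin 3) E}
  {Γ : Subgroup (GL (Fin 3) E)} (T : GL (Fin 3) ℂ)
  (hT : (T : Matrix (Fin 3) (Fin 3) ℂ)ᴴ * H.map E.subtype * (T : Matrix (Fin 3) (Fin 3) ℂ) = signatureMatrix 2)
  [ProperlyDiscontinuousSMul (lattice Γ T hT) Ball] [IsCancelSMul (lattice Γ T hT) Ball]

/-- **Holomorphy glue for the projection**: a function `k` on `Δ\𝔹²` which is manifold-differentiable at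
`coneProj v₀` gives, composed with the projection and extended to `ℂ³`, a function complex differentiable at
`v₀`. [cite: Shafarevich1994, Book 3 Ch. IX §3.2, auxiliary step] -/
theorem differentiableAt_coneExtend_comp_coneProj {k : orbitRel.Quotient (lattice Γ T hT) Ball → ℂ}
    {v₀ : Fin 3 → ℂ} (hv₀ : v₀ ∈ negCone (H.map E.subtype)) (c₀ : ℂ)
    (hk : MDifferentiableAt 𝓘(ℂ, Fin 2 → ℂ) 𝓘(ℂ, ℂ) k (coneProj T hT (Γ := Γ) ⟨v₀, hv₀⟩)) :
    DifferentiableAt ℂ (coneExtend (k ∘ coneProj T hT (Γ := Γ)) c₀) v₀ := by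
  have hJ := frame_J T hT
  -- `k ∘ mk` on the ball
  have hkk : MDifferentiableAt 𝓘(ℂ, Fin 2 → ℂ) 𝓘(ℂ, ℂ)
      (k ∘ Literature.Geometry.Manifold.QuotientManifold.mk (G := lattice Γ T hT)) (coneChart T hJ ⟨v₀, hv₀⟩) :=
    MDifferentiableAt.comp _ hk
      ((BallModel.contMDiff_mk (lattice Γ T hT)).mdifferentiableAt (by simp))
  -- in coordinates on `ℂ²`
  have hG := differentiableAt_comp_ballChart_symm hkk
  rw [coe_coneChart] at hG
  -- chain rule with the coordinate chart
  have hcomp := hG.comp v₀ (differentiableAt_coneChartVec T hJ hv₀)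
  refine (Filter.EventuallyEq.differentiableAt_iff ?_).1 hcomp
  filter_upwards [(isOpen_negCone (H.map E.subtype)).mem_nhds hv₀] with w hw
  rw [coneExtend_of_mem _ _ hw]
  change k (Literature.Geometry.Manifold.QuotientManifold.mk (ballChart.symm (coneChartVec T w))) = _
  rw [← coe_coneChart T hJ ⟨w, hw⟩]
  change k (Literature.Geometry.Manifold.QuotientManifold.mk
    (ballChart.symm ((fun z : Ball ↦ (z.1 : Fin 2 → ℂ)) (coneChart T hJ ⟨w, hw⟩)))) = _
  rw [BallModel.isOpenEmbedding_coe.toOpenPartialHomeomorph_left_inv]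
  rfl

end ProjectionHolomorphy

end Literature.AlgebraicGeometry.ShimuraVarieties.FramedCone

end
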